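import Summits.Schanuel.Schanuel.Theorems.RootDecomp1ERadixCell07
import Literature.NumberTheory.Transcendental.ExpOneTranscendenceMeasureProofs
import Mathlib.FieldTheory.KummerExtension
import Literature.NumberTheory.Transcendental.AlphaBetaTranscendenceMeasure

/-!
# RootDecomp1ELevelTransport — lens 2, generation 43 «POWER TRANSPORT — norm the transcendental LEVEL, not only the radix» (lanes E-R20 (β) + E-R19 (ii) + (α′); VERDICT L2157: THEOREM ×1 «hX-ELIMINATION on the tree class InRadixClass by level transport» + ONE CELL on the `√2·log 2`-weighted radix class `InQuadRadixClass` with E-STABLE members `zGS`, mod the ONE new print-faithful named fact `Waldschmidt1978_thm_4_7` (Literature)): the second resultant `powerNorm 𝔐 R₀ = Res_X(R₀(X), X^𝔐 − Y)` = the norm N_{ℚ(κ)(x)/ℚ(κ)} written in κ, transcendence TYPE as the only diophantine input, the λ-weighted radix curve, the level-transport engine, T1 binder-free radix line, T3 cells serving item 31409 — part 1 (RootDecomp1ELevelTransport01): §1 power norm + §2 transcendence type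

(lens-2 g43 HOME kernel LevelTransport.lean — graded copy 6f4fbb98… 1285 l; ported copy 746096cb… = graded + the critic's PORT CONDITION K:1117 `z ↦ w` in the carried IH binder of `cell_31410 (h47)` (one token, applied by the lens 17:36Z); imports tree RootDecomp1ERadixCell07 + Literature ExpOneTranscendenceMeasureProofs + Mathlib KummerExtension; CLAIM L2118, ACK/CHECKLIST E-g43 L2127, NODE L2152 / REQUEST L2153, writer re-check L2156, critic VERDICT L2157 (CLEARED as priced: THEOREM ×1 (T1) + ONE CELL (T3); lens-2 tally CELL ×5 + THEOREM ×1; RULE E-R21 L2158; PORT GO 01–0k `--supports stmt-Schanuel-31409`); port by census-1 gen 18 as `RootDecomp1ELevelTransport01`–`04`: 01 = §1 the power norm `powerNorm` / `norm_aeval_powerNorm` / `map_powerNorm_eq` / `natDegree_powerNorm` / `powerNorm_ne_zero` + §2 `TranscendenceType` (DEFINITION), `transcendenceType_exp_mul_log (h47)` (α^β has type 5); 02 = §3 the λ-weighted radix curve `radixPtL` + §4 engine helpers; 03 = §4 THE LEVEL-TRANSPORT ENGINE `algebraicIndependent_radixPtL_of_type` (scoped `maxHeartbeats 800000` as in K);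 04 = §5 T1 binder-free (`algebraicIndependent_radixPt_free`, `schanuel_inRadixClass_free`, `cell_25020_free` / `cell_31410_free`, `schanuel_zMix_towerNumber_free`), T3 `InQuadRadixClass` (DEFINITION), `transcendenceType_two_pow_sqrt_two (h47)`, `schanuel_inQuadRadixClass (h47)`, `cell_31409 (h47)` / `cell_25020 (h47)` / `cell_31410 (h47)`, members `zGS`, `eStable_zGS`, `schanuel_zGS_towerNumber (h47)`, separation, the dichotomy `not_transcendenceType_of_isAlgebraic` / `not_transcendenceType_two`.
PORT EDITS: the named fact `def Waldschmidt1978_thm_4_7` MOVED to the NEW Literature statement file Literature/NumberTheory/Transcendental/AlphaBetaTranscendenceMeasure.lean (census proposal, [cite: Waldschmidt1978, Thm 4.7]) and referenced through `open Literature.NumberTheory.Transcendental (Waldschmidt1978_thm_4_7)`; K's six private helpers as per-part private copies; statements and proofs otherwise verbatim (0 undocumented decls in K). `--supports stmt-Schanuel-31409`; no census credit carried; rung 0 — nothing here proves Schanuel; items 31409/25020/31410 stay OPEN.)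
-/

/-!
# RootDecomp1ELevelTransport — E-g43 «POWER TRANSPORT: norm the transcendental LEVEL, not only the radix»
(lens 2 «structural dichotomy (special vs generic)», gen 43; HOME kernel, imports tree parts `RootDecomp1ERadixCell01–07`
(g42, landed) BY NAME — no g42 declaration is re-declared; census ports to the tree as `RootDecomp1ELevelTransport0k`)

Route `route-Schanuel-RootDecomp1E`; items served POSITIONALLY (they stay OPEN): `stmt-Schanuel-25020 DefectOneSchanuel`,
`stmt-Schanuel-31410 PlainDefectOne`, and — for the first time in this lineage — `stmt-Schanuel-31409 EStableDefectOne`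
(binders VERBATIM + ONE class line; T3, mod ONE named fact).  `Schanuel` is NOT derived.

WHAT IT DOES.  g42 eliminated the RADIX root `2^{1/𝔐}` of a collapsed relation by the resultant norm
`R₀(X) = Res_Y(Y^𝔐 − 2, F(X,Y)) ∈ ℤ[X]` (tree parts 01–05) and then had to MEASURE the moving transcendental level
`x = e^{1/𝔐}` — Waldschmidt's approximation measure for `e^{r}` by algebraic numbers of growing degree, the registered
hypothesis `hX = ExplicitRatExpApprox`.  g43 norms the level as well:
* **the power norm** `R̃(Y) = Res_X(R₀(X), X^𝔐 − Y) ∈ ℤ[Y]` (§1) — this second resultant IS the field norm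
  `N_{ℚ(κ)(x)/ℚ(κ)}` of `R₀(x)` written as a polynomial in `κ = x^𝔐` (`R̃(κ) = ± ∏_{j<𝔐} R₀(ζ^j x)`), with
  `𝔐`-UNIFORM bookkeeping: `deg R̃ = deg R₀`, `M(R̃) = M(R₀)^𝔐`, `|R̃|_∞ ≤ 2^{deg R₀} M(R₀)^𝔐`;
* hence the ONLY diophantine input is a TRANSCENDENCE MEASURE FOR THE FIXED NUMBER `κ = e^λ` in Lang's polynomial
  form — a **transcendence type** `τ`: `|P(κ)| ≥ exp(−C (deg P + log H(P))^τ)` (§2; KNOWN TOOL: Lang's transcendence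
  type / the relative size inequality, LNM 402 §4.1 (4.1.1); W78 p. 445–446) — never an approximation measure at the
  moving point `e^{λ/𝔐}`.  REACH (critic's ex-ante price P0): new-combination-local — the engine is the known tool,
  the combination with g42's conjugate count and the `𝔐`-uniform transport budget is what is new here;
* `κ = e` (`λ = 1`): the type `3` is NW1996 Thm 4(2), **PROVED in the tree** (`NesterenkoWaldschmidt1996_thm_4_2_holds`):
  g42's Tier-2 class `InRadixClass` (tree part 07, UNCHANGED, same order `13·Σe + 4`) and its named member
  `schanuel_zMix_towerNumber` become HYPOTHESIS-FREE (§5 T1: `schanuel_inRadixClass_free`, `schanuel_zMix_towerNumber_free`);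
* `κ = 2^{√2}` (`λ = √2·log 2`): the type `5` follows from Waldschmidt 1978 Thm 4.7 (typed §2, print-faithful, ONE new
  named fact `Waldschmidt1978_thm_4_7`): the `√2·log 2`-weighted radix class `InQuadRadixClass` (order `10·Σe + 6`) carries
  `S` itself mod that fact, and its twin members `zGS k T = (√2 log 2·T^j, log 2·T^j)_{j≤k}` are **E-STABLE** (`β = √2`:
  `eStable_zGS`, proved) — a cell SERVING `EStableDefectOne` (§5 T3: `cell_31409`, `cell_31409_at_zGS`, `schanuel_zGS_towerNumber`).
FACTS: `Waldschmidt1978_thm_4_7` NEW (+1, binder `h47`, confined to §5 T3) · NW96 Thm 4(2) PROVED (tree) · Hermite–Lindemann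
PROVED (tree, separation only).  In-tree derivation of `h47`: none (`baker1975_thm_3_1` degree-opaque; `CijsouwWaldschmidt1977Main`
over `ℚ`).  (`κ = e^β`, β algebraic — W78 Cor 3.9, proved in the tree as `ExpAlgebraicTranscendenceMeasureProofs` — would be a
third supplier; not imported here: instance only.)

THE ENGINE (§4, `algebraicIndependent_radixPtL_of_type`): g42's Tier-2 collapse VERBATIM at the level `x_λ = e^{λ/𝔐}`
(§3 = the `λ`-weighted copies `ρrL/radixPtL/FRL/…` of the tree's `ρr/radixPt/FR/…`; parts 01–05 are `λ`-free and used BY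
NAME: `resNorm`, `resNorm_ne_zero`, `natDegree_resNorm_le`, `mahlerMeasure_resNorm_le`, `norm_aeval_resNorm`,
`hres_of_avoid`, `hsum_of_avoid`, `eventually_avoid`, `endgame_pure`, `pow_collapse_le_exp`, …), the conjugate bound on the
WHOLE circle `‖z‖ = x_λ`, then: constant `R₀` ⇒ `endgame_pure` (order `K + 2`); else `R̃ := powerNorm 𝔐 R₀`,
`‖R̃(κ)‖ ≤ M (q^D c)^{𝔐²} e^{−q^m}`, `deg R̃ ≤ c_N q^{2K}`, `log H(R̃) ≤ 3 + deg + wd²(D+c) q^{2K+1}` against the type: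
`exp(−C_t (N + log H)^τ) ≤ ‖R̃(κ)‖` — contradiction (`endgame_transport`) at ORDER `m ≥ (2K+1)·τ + 1`, `K = Σ_l e_l`
(closed forms: T1 needs `6K + 4 ≤ 13K + 4`; T3 `m₀ = 10K + 6`).
DICHOTOMY at the level (§5): an ALGEBRAIC `κ` has no type (`not_transcendenceType_of_isAlgebraic`, `not_transcendenceType_two`):
the pure radix line `κ = 2` is NOT an instance — it is the tree's free Tier 1 (`algebraicIndependent_radixPt_pure`).
-/

noncomputable section

open Complex Polynomial IntermediateField Filter
open scoped BigOperators Topology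

namespace Summit.Schanuel.Schanuel.Theorems.RootDecomp1ELevelTransport

open Summit.Schanuel.Schanuel.Theorems.RootDecomp1ERadixCell
open Summit.Schanuel.Schanuel.Theorems.RootDecomp1EUntwistedWall (gι gaussPt expo coef tail fib IsZ wden wden_pos
  isZ_expo Wb Wb_nonneg abs_expo_le abs_coef_le coef_cast fib_ne_zero expo_eq_of_tail_eq)
open Summit.Schanuel.Schanuel.Theorems.RootDecomp1KHyper
open Summit.Schanuel.Schanuel.Theorems.RootDecomp1KHyper.HyperCell
open Summit.Schanuel.Schanuel.Theorems.RootDecomp1KGeneric (LiouvilleOrder)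
open Summit.Schanuel.Schanuel.Theorems.RootDecomp1KFiniteOrderCell (towerNumber liouvilleOrder_towerNumber
  not_hyperLiouville_towerNumber towerNumber_pos not_liouvilleOrder_towerNumber)
open Summit.Schanuel.Schanuel.Theorems.RootDecomp1BDefectFloorCells (natCast_le_trdeg_of_algebraicIndependent)
open Summit.Schanuel.Schanuel.Theorems.RootDecomp1BRadicalDescent (exists_int_relation)
open Literature.NumberTheory.Transcendental (Waldschmidt1978_thm_4_7)

/-! ## §1  THE POWER NORM `R̃(Y) = Res_X(R(X), X^𝔐 − Y)` — transport algebra -/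

section Transport

/-- **THE POWER NORM** of an integer polynomial: `R̃(Y) = Res_X(R(X), X^𝔐 − Y) ∈ ℤ[Y]` — the norm of the value
`R(x)` from `ℚ(x)` to `ℚ(x^𝔐)` written as a polynomial in `Y = x^𝔐`: `R̃(x^𝔐) = ± ∏_{j<𝔐} R(ζ_𝔐^j x)`.
(Outer variable = the eliminated `X`; the coefficient ring `ℤ[Y]` carries `Y`.) -/
def powerNorm (M : ℕ) (R : ℤ[X]) : ℤ[X] :=
  resultant (R.map (C : ℤ →+* ℤ[X])) ((X : ℤ[X][X]) ^ M - C (X : ℤ[X])) R.natDegree M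

/-- `eval x (R.map (Int.castRingHom ℂ)) = aeval x R`. -/
private theorem eval_map_intCast' (R : ℤ[X]) (x : ℂ) : (R.map (Int.castRingHom ℂ)).eval x = aeval x R := by
  rw [Polynomial.eval_map, Polynomial.aeval_def, algebraMap_int_eq]

/-- `Res(C r · f, g) = r^n · Res(f, g)`. -/
theorem resultant_C_mul_left' {R : Type*} [CommRing R] (f g : R[X]) (m n : ℕ) (r : R) :
    resultant (C r * f) g m n = r ^ n * resultant f g m n := by
  rw [resultant_comm (C r * f) g m n, resultant_C_mul_right, resultant_comm f g m n]; ring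

/-- `Res(∏_{b ∈ t} (X − b), g) = ∏_{b ∈ t} g(b)` for a multiset `t` (repeated roots allowed). -/
theorem resultant_multiset_prod_X_sub_C_left {R : Type*} [CommRing R] [IsDomain R] (t : Multiset R) (g : R[X])
    (n : ℕ) (hg : g.natDegree ≤ n) :
    resultant (t.map (X - C ·)).prod g (Multiset.card t) n = (t.map fun b => g.eval b).prod := by
  induction t using Multiset.induction with
  | empty => simp
  | cons a t ih =>
    rw [Multiset.map_cons, Multiset.prod_cons, Multiset.map_cons, Multiset.prod_cons, Multiset.card_cons]
    have hdeg : Multiset.card t + 1 = (X - C a).natDegree + (t.map (X - C ·)).prod.natDegree := by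
      rw [natDegree_X_sub_C, natDegree_multiset_prod_X_sub_C_eq_card]; ring
    rw [hdeg, resultant_mul_left _ _ _ n hg, natDegree_X_sub_C, resultant_X_sub_C_left _ _ _ hg,
      natDegree_multiset_prod_X_sub_C_eq_card, ih]

/-- **VALUE OF THE POWER NORM AT `κ = x^𝔐`**: `‖R̃(κ)‖ = ∏_{j<𝔐} ‖R(ζ^j x)‖`. -/
theorem norm_aeval_powerNorm {M : ℕ} (hM : 0 < M) (R : ℤ[X]) {x κ : ℂ} (hx : x ^ M = κ) :
    ‖aeval κ (powerNorm M R)‖ = ∏ j ∈ Finset.range M, ‖aeval (zroot M ^ j * x) R‖ := by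
  set φ : ℤ[X] →+* ℂ := (aeval κ : ℤ[X] →ₐ[ℤ] ℂ).toRingHom with hφ
  have h1 : resultant ((R.map (C : ℤ →+* ℤ[X])).map φ) (((X : ℤ[X][X]) ^ M - C (X : ℤ[X])).map φ)
      R.natDegree M = φ (powerNorm M R) := resultant_map_map _ _ _ _ φ
  have hf : (R.map (C : ℤ →+* ℤ[X])).map φ = R.map (Int.castRingHom ℂ) := by
    rw [Polynomial.map_map, RingHom.eq_intCast' (φ.comp C)]
  have hg : ((X : ℤ[X][X]) ^ M - C (X : ℤ[X])).map φ = X ^ M - C κ := by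
    rw [Polynomial.map_sub, Polynomial.map_pow, Polynomial.map_X, Polynomial.map_C, hφ]
    simp
  have hφR : φ (powerNorm M R) = aeval κ (powerNorm M R) := rfl
  rw [← hφR, ← h1, hf, hg]
  set RC : ℂ[X] := R.map (Int.castRingHom ℂ) with hRC
  have hRCdeg : RC.natDegree ≤ R.natDegree := natDegree_map_le
  have hζ := isPrimitiveRoot_zroot hM.ne'
  rw [X_pow_sub_C_eq_prod hζ hM hx]
  have hdegP : (∏ j ∈ Finset.range M, (X - C (zroot M ^ j * x)) : ℂ[X]).natDegree = M := by
    rw [natDegree_prod_of_monic _ _ fun j _ => monic_X_sub_C _]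
    simp only [natDegree_X_sub_C, Finset.sum_const, Finset.card_range, smul_eq_mul, mul_one]
  have h2 := resultant_prod_right (Finset.range M) RC (fun j => (X - C (zroot M ^ j * x) : ℂ[X]))
    R.natDegree hRCdeg (by rw [Finset.prod_eq_one fun j _ => leadingCoeff_X_sub_C _]; exact one_ne_zero)
  beta_reduce at h2
  rw [hdegP] at h2
  simp_rw [natDegree_X_sub_C, resultant_X_sub_C_right _ _ _ hRCdeg] at h2
  rw [h2, norm_prod]
  refine Finset.prod_congr rfl fun j _ => ?_
  rw [norm_mul, norm_pow, norm_neg, norm_one, one_pow, one_mul, hRC, eval_map_intCast']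

/-- **STRUCTURE OF THE POWER NORM OVER `ℂ`**: `R̃ = C((-1)^N lc(R)^𝔐) · ∏_{ρ ∈ roots R} (Y − ρ^𝔐)`, `N = deg R`. -/
theorem map_powerNorm_eq (M : ℕ) (R : ℤ[X]) :
    (powerNorm M R).map (Int.castRingHom ℂ) =
      C ((-1) ^ R.natDegree * ((R.map (Int.castRingHom ℂ)).leadingCoeff) ^ M) *
        (((R.map (Int.castRingHom ℂ)).roots.map (· ^ M)).map (X - C ·)).prod := by
  set RC : ℂ[X] := R.map (Int.castRingHom ℂ) with hRC
  set ψ' : ℤ[X] →+* ℂ[X] := mapRingHom (Int.castRingHom ℂ) with hψ'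
  set g : ℂ[X][X] := (X : ℂ[X][X]) ^ M - C (X : ℂ[X]) with hgdef
  have h1 : resultant ((R.map (C : ℤ →+* ℤ[X])).map ψ') (((X : ℤ[X][X]) ^ M - C (X : ℤ[X])).map ψ')
      R.natDegree M = ψ' (powerNorm M R) := resultant_map_map _ _ _ _ ψ'
  have hψR : ψ' (powerNorm M R) = (powerNorm M R).map (Int.castRingHom ℂ) := by rw [hψ', coe_mapRingHom]
  have hf : (R.map (C : ℤ →+* ℤ[X])).map ψ' = RC.map (C : ℂ →+* ℂ[X]) := by
    rw [Polynomial.map_map, hRC, Polynomial.map_map, RingHom.eq_intCast' (ψ'.comp C),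
      RingHom.eq_intCast' ((C : ℂ →+* ℂ[X]).comp (Int.castRingHom ℂ))]
  have hg : ((X : ℤ[X][X]) ^ M - C (X : ℤ[X])).map ψ' = g := by
    rw [Polynomial.map_sub, Polynomial.map_pow, Polynomial.map_X, Polynomial.map_C, hψ', coe_mapRingHom,
      Polynomial.map_X]
  rw [← hψR, ← h1, hf, hg]
  -- factor `RC` over `ℂ`
  have hcard : Multiset.card RC.roots = RC.natDegree := splits_iff_card_roots.mp (IsAlgClosed.splits RC)
  have hRCN : RC.natDegree = R.natDegree := by
    rw [hRC, natDegree_map_eq_of_injective (RingHom.injective_int _)]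
  have hfac : RC.map (C : ℂ →+* ℂ[X]) =
      C (C RC.leadingCoeff) * ((RC.roots.map (C : ℂ → ℂ[X])).map (X - C ·)).prod := by
    conv_lhs => rw [← C_leadingCoeff_mul_prod_multiset_X_sub_C hcard]
    rw [Polynomial.map_mul, Polynomial.map_C, Polynomial.map_multiset_prod, Multiset.map_map, Multiset.map_map]
    congr 1
    refine congrArg Multiset.prod (Multiset.map_congr rfl fun a _ => ?_)
    simp
  have hgM : g.natDegree ≤ M := by rw [hgdef]; exact (natDegree_X_pow_sub_C (r := (X : ℂ[X]))).le
  have h3 := resultant_multiset_prod_X_sub_C_left (RC.roots.map (C : ℂ → ℂ[X])) g M hgM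
  rw [Multiset.card_map, hcard, hRCN] at h3
  rw [hfac, resultant_C_mul_left', h3]
  have hprod : ((RC.roots.map (C : ℂ → ℂ[X])).map fun b => g.eval b).prod =
      (-1) ^ R.natDegree * ((RC.roots.map (· ^ M)).map (X - C ·)).prod := by
    have e1 : ((RC.roots.map (C : ℂ → ℂ[X])).map fun b => g.eval b) =
        (((RC.roots.map (· ^ M)).map (X - C ·)).map Neg.neg) := by
      rw [Multiset.map_map, Multiset.map_map, Multiset.map_map]
      refine Multiset.map_congr rfl fun a _ => ?_
      simp [hgdef, eval_sub, eval_pow, eval_X, eval_C]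
    rw [e1, Multiset.prod_map_neg, Multiset.card_map, Multiset.card_map, hcard, hRCN]
  rw [hprod, C_mul, C_pow, C_pow, C_neg, C_1]
  ring

/-- The constant of the factorisation of `R̃` is non-zero. -/
private theorem const_ne_zero (M : ℕ) {R : ℤ[X]} (hR : R ≠ 0) :
    ((-1 : ℂ) ^ R.natDegree * ((R.map (Int.castRingHom ℂ)).leadingCoeff) ^ M) ≠ 0 := by
  refine mul_ne_zero (pow_ne_zero _ (neg_ne_zero.mpr one_ne_zero)) (pow_ne_zero _ ?_)
  rw [Polynomial.leadingCoeff_map_of_injective (RingHom.injective_int _), eq_intCast, Int.cast_ne_zero]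
  exact Polynomial.leadingCoeff_ne_zero.mpr hR

/-- **`deg R̃ = deg R`.** -/
theorem natDegree_powerNorm (M : ℕ) {R : ℤ[X]} (hR : R ≠ 0) : (powerNorm M R).natDegree = R.natDegree := by
  rw [← natDegree_map_eq_of_injective (RingHom.injective_int (Int.castRingHom ℂ)), map_powerNorm_eq,
    natDegree_C_mul (const_ne_zero M hR), natDegree_multiset_prod_X_sub_C_eq_card, Multiset.card_map,
    ← natDegree_map_eq_of_injective (RingHom.injective_int (Int.castRingHom ℂ)) (f := Int.castRingHom ℂ)]
  exact (splits_iff_card_roots.mp (IsAlgClosed.splits _))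

/-- **`R̃ ≠ 0`.** -/
theorem powerNorm_ne_zero (M : ℕ) {R : ℤ[X]} (hR : R ≠ 0) : powerNorm M R ≠ 0 := by
  intro h0
  have h := map_powerNorm_eq M R
  rw [h0, Polynomial.map_zero] at h
  exact (mul_ne_zero (C_ne_zero.mpr (const_ne_zero M hR)) (monic_multisetProd_X_sub_C _).ne_zero) h.symm

/-- `max 1 (t^𝔐) = (max 1 t)^𝔐` for `t ≥ 0`. -/
private theorem max_one_pow {t : ℝ} (ht : 0 ≤ t) (M : ℕ) : max 1 (t ^ M) = (max 1 t) ^ M := by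
  rcases le_total t 1 with h | h
  · rw [max_eq_left (pow_le_one₀ ht h), max_eq_left h, one_pow]
  · rw [max_eq_right (one_le_pow₀ h), max_eq_right h]

/-- **`M(R̃) = M(R)^𝔐`** (Mahler measures over `ℂ`). -/
theorem mahlerMeasure_powerNorm (M : ℕ) (R : ℤ[X]) :
    ((powerNorm M R).map (Int.castRingHom ℂ)).mahlerMeasure = ((R.map (Int.castRingHom ℂ)).mahlerMeasure) ^ M := by
  set RC : ℂ[X] := R.map (Int.castRingHom ℂ) with hRC
  rw [map_powerNorm_eq, mahlerMeasure_mul, mahlerMeasure_const,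
    mahlerMeasure_eq_leadingCoeff_mul_prod_roots ((((RC.roots.map (· ^ M)).map (X - C ·)).prod)),
    (monic_multisetProd_X_sub_C _).leadingCoeff, norm_one, one_mul, roots_multiset_prod_X_sub_C,
    mahlerMeasure_eq_leadingCoeff_mul_prod_roots RC, norm_mul, norm_pow, norm_pow, norm_neg, norm_one, one_pow,
    one_mul, mul_pow, Multiset.map_map, ← Multiset.prod_map_pow]
  congr 1
  refine congrArg Multiset.prod (Multiset.map_congr rfl fun a _ => ?_)
  simp only [Function.comp_apply, norm_pow]
  exact max_one_pow (norm_nonneg a) M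

/-- **HEIGHT OF THE POWER NORM**: `|coeff_k R̃| ≤ 2^{deg R} · M(R)^𝔐`. -/
theorem abs_coeff_powerNorm_le (M : ℕ) {R : ℤ[X]} (hR : R ≠ 0) (k : ℕ) :
    (|(powerNorm M R).coeff k| : ℝ) ≤ 2 ^ R.natDegree * ((R.map (Int.castRingHom ℂ)).mahlerMeasure) ^ M := by
  have h1 := norm_coeff_le_choose_mul_mahlerMeasure k ((powerNorm M R).map (Int.castRingHom ℂ))
  rw [Polynomial.coeff_map, eq_intCast, Complex.norm_intCast, mahlerMeasure_powerNorm M R,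
    natDegree_map_eq_of_injective (RingHom.injective_int _), natDegree_powerNorm M hR] at h1
  refine h1.trans (mul_le_mul_of_nonneg_right ?_ (pow_nonneg (mahlerMeasure_nonneg _) _))
  exact_mod_cast Nat.choose_le_two_pow R.natDegree k

/-- `‖G_i(z)‖ ≤ Σ_s |κ_s| c_𝔐^{B_s} x^{A_s}` for a COMPLEX argument of modulus `‖z‖ = x`. -/
theorem norm_eval_Gfac_le_of_norm_eq {σ : Type*} {M : ℕ} (hM : M ≠ 0) (S : Finset σ) (κ : σ → ℤ) (A B : σ → ℕ)
    (i : ℕ) {z : ℂ} {x : ℝ} (hz : ‖z‖ = x) :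
    ‖(Gfac M S κ A B i).eval z‖ ≤ ∑ s ∈ S, |(κ s : ℝ)| * croot M ^ B s * x ^ A s := by
  rw [Gfac, eval_finsetSum]
  refine (norm_sum_le _ _).trans (Finset.sum_le_sum fun s _ => le_of_eq ?_)
  rw [eval_mul, eval_pow, eval_C, eval_X, norm_mul, norm_mul, norm_pow, norm_pow, norm_broot hM,
    Complex.norm_intCast, hz]

/-- `‖ζ_𝔐^j · x‖ = x` for real `x ≥ 0`. -/
theorem norm_zroot_pow_mul {M : ℕ} (hM : M ≠ 0) (j : ℕ) {x : ℝ} (hx : 0 ≤ x) :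
    ‖zroot M ^ j * (x : ℂ)‖ = x := by
  rw [norm_mul, norm_pow, norm_zroot hM, one_pow, one_mul, Complex.norm_real, Real.norm_of_nonneg hx]

end Transport

/-! ## §2  TRANSCENDENCE TYPE (Lang; Waldschmidt 1978 p. 445–446) — the ONLY diophantine input of the engine -/

section TType

/-- **TRANSCENDENCE TYPE** of a complex number `ω` (Lang; Waldschmidt 1978, p. 445–446: "a real number `τ ≥ 2` is a
transcendence type for `ω` if there exists `C(ω,τ) > 0` such that `C(ω,τ)(log H + N)^τ` is a transcendence measure
for `ω`", a transcendence measure `φ(N, log H)` being a lower bound `log |P(ω)| ≥ −φ` for every non-zero `P ∈ ℤ[X]` of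
degree `≤ N`, `N ≥ 1`, and usual height `≤ H`, `H ≥ 16`). -/
def TranscendenceType (ω : ℂ) (τ : ℕ) : Prop :=
  ∃ C : ℝ, 0 < C ∧ ∀ (P : ℤ[X]) (N H : ℕ), P ≠ 0 → 1 ≤ N → P.natDegree ≤ N → 16 ≤ H →
    (∀ k, |P.coeff k| ≤ (H : ℤ)) → Real.exp (-(C * ((N : ℝ) + Real.log H) ^ τ)) ≤ ‖aeval ω P‖

/-- A transcendence type may be weakened: type `τ` ⇒ type `τ'` for `τ ≤ τ'` (as `N + log H ≥ 1`). -/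
theorem TranscendenceType.mono {ω : ℂ} {τ τ' : ℕ} (h : TranscendenceType ω τ) (hτ : τ ≤ τ') :
    TranscendenceType ω τ' := by
  obtain ⟨C, hC, hm⟩ := h
  refine ⟨C, hC, fun P N H hP hN hdeg hH hcoef => le_trans (Real.exp_le_exp.mpr ?_) (hm P N H hP hN hdeg hH hcoef)⟩
  have hH1 : (1 : ℝ) ≤ (N : ℝ) + Real.log H := by
    have h1 : (1 : ℝ) ≤ N := by exact_mod_cast hN
    have h2 : 0 ≤ Real.log H := Real.log_nonneg (by exact_mod_cast (show 1 ≤ H by omega))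
    linarith
  have := pow_le_pow_right₀ hH1 hτ
  nlinarith

/-- **`e` HAS TRANSCENDENCE TYPE `3` — PROVED** (from the tree theorem `NesterenkoWaldschmidt1996_thm_4_2_holds`,
NW1996 Thm 4(2): `|P(e)| ≥ exp(−1.3·10⁵ d²(log L + d))`, `L ≥ Σ|coeff|`; with `L = (N+1)H`:
`d²(log L + d) ≤ 2 (N + log H)^3`). -/
theorem transcendenceType_exp_one : TranscendenceType (cexp 1) 3 := by
  refine ⟨2 * (1.3 * 10 ^ 5), by norm_num, fun P N H hP hN hdeg hH hcoef => ?_⟩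
  have hmain := Literature.NumberTheory.Transcendental.NesterenkoWaldschmidt1996_thm_4_2_holds P N ((N + 1) * H)
    hP hN hdeg ?_ ?_
  · have he : (Real.exp 1 : ℂ) = cexp 1 := by rw [Complex.ofReal_exp, Complex.ofReal_one]
    rw [he] at hmain
    refine le_trans (Real.exp_le_exp.mpr ?_) hmain
    have hN1 : (1 : ℝ) ≤ N := by exact_mod_cast hN
    have hH16 : (16 : ℝ) ≤ H := by exact_mod_cast hH
    have hlogH : 0 ≤ Real.log H := Real.log_nonneg (by linarith)
    have hlogN1 : Real.log ((N : ℝ) + 1) ≤ N := by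
      have := Real.add_one_le_exp (N : ℝ)
      have h2 : Real.log ((N : ℝ) + 1) ≤ Real.log (Real.exp N) := Real.log_le_log (by linarith) this
      rwa [Real.log_exp] at h2
    have hL : Real.log ((((N + 1) * H : ℕ) : ℝ)) = Real.log ((N : ℝ) + 1) + Real.log H := by
      push_cast
      rw [Real.log_mul (by positivity) (by linarith)]
    rw [hL]
    have hΦ : (N : ℝ) ≤ (N : ℝ) + Real.log H := by linarith
    have h3 : Real.log ((N : ℝ) + 1) + Real.log H + N ≤ 2 * ((N : ℝ) + Real.log H) := by linarith
    have h4 : (N : ℝ) ^ 2 ≤ ((N : ℝ) + Real.log H) ^ 2 := pow_le_pow_left₀ (by positivity) hΦ 2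
    have h5 : 0 ≤ Real.log ((N : ℝ) + 1) + Real.log H + N := by
      have : 0 ≤ Real.log ((N : ℝ) + 1) := Real.log_nonneg (by linarith)
      positivity
    nlinarith [h4, h3, h5, sq_nonneg ((N : ℝ) + Real.log H)]
  · -- `Σ_{k ≤ deg P} |coeff_k| ≤ (N+1)·H`
    calc (∑ k ∈ Finset.range (P.natDegree + 1), |P.coeff k|) ≤ ∑ _k ∈ Finset.range (P.natDegree + 1), (H : ℤ) :=
          Finset.sum_le_sum fun k _ => hcoef k
      _ = ((P.natDegree + 1 : ℕ) : ℤ) * H := by rw [Finset.sum_const, Finset.card_range, nsmul_eq_mul]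
      _ ≤ (((N + 1) * H : ℕ) : ℤ) := by push_cast; gcongr
  · calc (3 : ℕ) ≤ 1 * 16 := by norm_num
      _ ≤ (N + 1) * H := Nat.mul_le_mul (by omega) hH

/-- `log (log 16) ≥ 1`, i.e. `log 16 ≥ e`. -/
private theorem one_le_log_log_sixteen : 1 ≤ Real.log (Real.log 16) := by
  have h2 : Real.log 16 = 4 * Real.log 2 := by
    rw [show (16 : ℝ) = 2 ^ 4 by norm_num, Real.log_pow]; norm_num
  have he : Real.exp 1 ≤ Real.log 16 := by
    rw [h2]; linarith [Real.exp_one_lt_d9, Real.log_two_gt_d9]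
  have := Real.log_le_log (Real.exp_pos 1) he
  rwa [Real.log_exp] at this

/-- **`α^β` HAS TRANSCENDENCE TYPE `5`** modulo `Waldschmidt1978_thm_4_7` (print: type `4`, Waldschmidt 1978 Fig. 1;
the crude `5` is what `log N ≤ N`, `log log H ≤ log H`, `(1 + log N)² ≥ 1` give and is all the engine needs). -/
theorem transcendenceType_exp_mul_log (h47 : Waldschmidt1978_thm_4_7) {ℓ β : ℂ} (hℓ : ℓ ≠ 0)
    (hα : IsAlgebraic ℚ (cexp ℓ)) (hβ : IsAlgebraic ℚ β) (hβirr : β ∉ Set.range (algebraMap ℚ ℂ)) :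
    TranscendenceType (cexp (β * ℓ)) 5 := by
  obtain ⟨C, hC, hm⟩ := h47 ℓ β hℓ hα hβ hβirr
  refine ⟨C, hC, fun P N H hP hN hdeg hH hcoef => le_trans (Real.exp_le_exp.mpr ?_) (hm P N H hP hN hdeg hH hcoef)⟩
  have hN1 : (1 : ℝ) ≤ N := by exact_mod_cast hN
  have hH16 : (16 : ℝ) ≤ H := by exact_mod_cast hH
  have hlogH : Real.log 16 ≤ Real.log H := Real.log_le_log (by norm_num) hH16
  have hlogN : Real.log N ≤ N := (Real.log_le_sub_one_of_pos (by linarith)).trans (by linarith)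
  have hlogN0 : 0 ≤ Real.log N := Real.log_nonneg hN1
  have hlogH1 : 1 ≤ Real.log H := by
    have := one_le_log_log_sixteen
    have h0 : Real.log (Real.log 16) ≤ Real.log 16 :=
      (Real.log_le_sub_one_of_pos (Real.log_pos (by norm_num))).trans (by linarith)
    linarith
  have hllH : Real.log (Real.log H) ≤ Real.log H :=
    (Real.log_le_sub_one_of_pos (by linarith)).trans (by linarith)
  have hllH1 : 1 ≤ Real.log (Real.log H) := one_le_log_log_sixteen.trans (Real.log_le_log (by
    exact Real.log_pos (by norm_num)) hlogH)
  set Φ : ℝ := (N : ℝ) + Real.log H with hΦ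
  have hA : Real.log H + Real.log N ≤ Φ := by rw [hΦ]; linarith
  have hB : Real.log (Real.log H) + Real.log N ≤ Φ := by rw [hΦ]; linarith
  have hA0 : 0 ≤ Real.log H + Real.log N := by linarith
  have hB0 : 0 ≤ Real.log (Real.log H) + Real.log N := by linarith
  have hNΦ : (N : ℝ) ≤ Φ := by rw [hΦ]; linarith
  have hden : 1 ≤ (1 + Real.log N) ^ 2 := by nlinarith
  have hnum : C * (N : ℝ) ^ 3 * (Real.log H + Real.log N) * (Real.log (Real.log H) + Real.log N) ≤ C * Φ ^ 5 := by
    have hN3 : (N : ℝ) ^ 3 ≤ Φ ^ 3 := pow_le_pow_left₀ (by positivity) hNΦ 3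
    calc C * (N : ℝ) ^ 3 * (Real.log H + Real.log N) * (Real.log (Real.log H) + Real.log N)
        ≤ C * Φ ^ 3 * Φ * Φ := by gcongr
      _ = C * Φ ^ 5 := by ring
  have hdiv : C * (N : ℝ) ^ 3 * (Real.log H + Real.log N) * (Real.log (Real.log H) + Real.log N) /
      (1 + Real.log N) ^ 2 ≤ C * Φ ^ 5 :=
    (div_le_self (by positivity) hden).trans hnum
  linarith

end TType

end Summit.Schanuel.Schanuel.Theorems.RootDecomp1ELevelTransport

end
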